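import Summits.HubbardSuperconductivity.HubbardSuperconductivity.Theorems.BalabanIRBirEveryGroundStateSchur
import HarnessLib

/-!
# Crux `MesoscopicPairOrder` (item `stmt-HubbardSuperconductivity-7331`), line `Sketch`:
# the chord inequality (`stub_chordFloor`)

Helper (`--supports stmt-HubbardSuperconductivity-7331`) for the crux
`Summit.HubbardSuperconductivity.HubbardSuperconductivity.Theses.FunctionFieldCertificate.MesoscopicPairOrder`,
line `Sketch`, stub `stub_chordFloor`.

**Statement (`stub_chordFloor`).** For a normalised ground state `ψ` of the Hubbard torus
Hamiltonian `H = hubbardTorus 2 L 1 U` in the joint sector `K = szSector N 0`, ANY matrix `Y` and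
`ε > 0`: `E_K(H + εY) - E_K(H) ≤ ε Re⟨ψ, Y ψ⟩` (`E_K = Matrix.minEnergyOn · K`).

**Proof.** `ψ` is a trial state for `H + εY` in `K` (`Theorems.minEnergyOn_le_re_rayleigh`) and
`Re⟨ψ, (H + εY) ψ⟩ = E_K(H) + ε Re⟨ψ, Y ψ⟩` by the eigenvalue equation packaged in
`IsGroundStateInSector`; this is the tree's `Theorems.chord_div_le_re_expect_of_eigen`, multiplied
through by `ε`. No hermiticity or sector preservation of `Y` is needed.

No definition introduced, folklore; Tasaki (2020) §2.1 (variational principle).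
-/

noncomputable section

-- the summit namespace repeats the problem name by design (D-0017)
set_option linter.dupNamespace false

namespace Summit.HubbardSuperconductivity.HubbardSuperconductivity.Theorems.FunctionFieldCertificate

open Matrix Finset Filter
open Literature.Probability.LatticeModels Literature.MathematicalPhysics.QuantumLattice
open scoped ComplexOrder

/-- **The chord inequality** (stub `stub_chordFloor` of line `Sketch`). For a normalised ground
state `ψ` of `H = hubbardTorus 2 L 1 U` in the sector `K = szSector N 0`, ANY matrix `Y` and
`ε > 0`: `E_K(H + εY) - E_K(H) ≤ ε Re⟨ψ, Y ψ⟩` (`E_K = Matrix.minEnergyOn · K`): the penalised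
sector energy is at most the Rayleigh quotient of `H + εY` at the trial state `ψ`, which is
`E_K(H) + ε Re⟨ψ, Y ψ⟩` by the eigenvalue equation of `IsGroundStateInSector`. No hermiticity or
sector preservation of `Y` is needed. Tasaki (2020) §2.1; tree:
`Theorems.chord_div_le_re_expect_of_eigen`. [folklore] -/
theorem stub_chordFloor : ∀ (L : ℕ) [NeZero L] (U ε : ℝ) (N : ℕ)
    (Y : Matrix (Finset (Orb (FermionTorus 2 L))) (Finset (Orb (FermionTorus 2 L))) ℂ)
    (ψ : Fock (Orb (FermionTorus 2 L))), 0 < ε → star ψ ⬝ᵥ ψ = 1 →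
    IsGroundStateInSector (hubbardTorus 2 L 1 U) N 0 ψ →
    (hubbardTorus 2 L 1 U + (ε : ℂ) • Y).minEnergyOn (szSector N 0) -
        (hubbardTorus 2 L 1 U).minEnergyOn (szSector N 0) ≤ ε * (star ψ ⬝ᵥ Y *ᵥ ψ).re := by
  intro L _ U ε N Y ψ hε hψ hgs
  obtain ⟨hψK, -, heig⟩ := hgs
  have h := chord_div_le_re_expect_of_eigen (hubbardTorus 2 L 1 U) Y (szSector N 0) hε hψK hψ heig
  rw [div_le_iff₀ hε] at h
  linarith [h]

end Summit.HubbardSuperconductivity.HubbardSuperconductivity.Theorems.FunctionFieldCertificate
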